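import Literature.NumberTheory.EllipticCurves.Kobayashi2003.SignedPAdicLFunctionUniqueProofs
import Literature.NumberTheory.EllipticCurves.Kobayashi2003.SignedPAdicLFunctionConstantTermProofs
import Literature.NumberTheory.EllipticCurves.PlusMinusPAdicLFunctionProofs
import HarnessLib

/-!
# Kobayashi's signed `p`-adic `L`-functions `L_p^ε(E, X)` exist, unconditionally
# (Pollack 2003, Thm. 5.6 / Cor. 5.11 / Prop. 6.18 — now a tree theorem; Kobayashi 2003, Thm. 3.2)

Topic `NumberTheory/EllipticCurves/Kobayashi2003`; theorems only. The files
`SignedKatoDivisibility` (`exists_isSignedPAdicLFunction`), `SignedPAdicLFunctionUniqueProofs`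
(`existsUnique_isSignedPAdicLFunction`) and `SignedPAdicLFunctionConstantTermProofs` took Pollack's
existence theorem as the named-fact hypothesis
`(h : pollack_exists_plusMinusPAdicLFunction (W := W) (f := f) (p := p))`. That fact is now PROVED
(`Literature.NumberTheory.EllipticCurves.pollack_exists_plusMinusPAdicLFunction_holds`, file
`PlusMinusPAdicLFunctionProofs`: algebraic reconstruction of `L^±` from the Mazur–Tate elements,
non-vanishing by Rohrlich), so we record the UNCONDITIONAL forms: for `p` odd, `f` the newform of
`E = W`, `E` with good reduction at `p` and `a_p(E) = 0`, and either sign `ε`,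

* `exists_ne_zero_and_isSignedPAdicLFunction` — there is `L ∈ Λ`, `L ≠ 0`, with
  `IsSignedPAdicLFunction f p ε L` (Kobayashi's `L_p^ε(E, X)`, Invent. Math. 152 (2003) Thm. 3.2,
  in his labelling: `ε = 1` is the tree's/Pollack's `L⁻`);
* `existsUnique_isSignedPAdicLFunction_holds` — it is unique, and every such `L` is non-zero;
* `exists_isSignedPAdicLFunction_constantCoeff_eq` — the unique `L_p^ε` has constant term
  `c_ε · [0]⁺_f` with `c_+ = 2`, `c_− = p − 1` (Kobayashi (3.6), `Ω⁺_f`-normalisation; from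
  `IsSignedPAdicLFunction.constantCoeff_eq_of_eq_one/_of_eq_neg_one`).

No new definition, no named fact; net debt `0` (this file) after `−1` (the Pollack proof).

## References

* R. Pollack, Duke Math. J. 118 (2003), Thm. 5.6, Cor. 5.11, Prop. 6.18 [Pollack2003].
* S. Kobayashi, Invent. Math. 152 (2003), Thm. 3.2 and (3.6) (p. 7)
  [corpus: paper:doi-10-1007-s00222-002-0265-4 p. 7] [Kobayashi2003].
-/

noncomputable section

open scoped MatrixGroups ModularForm

open CongruenceSubgroup Polynomial Literature.NumberTheory.EllipticCurves
  Literature.NumberTheory.EllipticCurves.ModularForms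

namespace Literature.NumberTheory.EllipticCurves.Kobayashi2003

variable {N : ℕ} [NeZero N] {f : CuspForm (Gamma0 N) 2} {p : ℕ} [Fact p.Prime]
  {W : WeierstrassCurve ℚ} [W.IsElliptic] [W.IsGloballyMinimal]

/-- **Kobayashi's `L_p^ε(E, X)` exists and is non-zero**, unconditionally: for `p` odd, `f` the
newform of `E = W`, good reduction at `p`, `a_p = 0`, and `ε = ±1`, there is `L ∈ Λ = ℤ_p⟦T⟧`,
`L ≠ 0`, satisfying Pollack's congruences of sign `ε` (`IsSignedPAdicLFunction f p ε L`)
(Pollack 2003, Thm. 5.6 / Cor. 5.11 / Prop. 6.18 = `pollack_exists_plusMinusPAdicLFunction_holds`;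
Kobayashi 2003, Thm. 3.2). [cite: Pollack2003, Thm. 5.6, Cor. 5.11 and Prop. 6.18] [cite: Kobayashi2003, Thm. 3.2 (p. 7)] -/
theorem exists_ne_zero_and_isSignedPAdicLFunction (hp : p ≠ 2) (hf : IsNewformOf W f)
    (hgood : W.HasGoodReductionAtPrime p) (hap : W.frobeniusTrace p = 0) (ε : ℤˣ) :
    ∃ L : IwasawaAlgebra p, L ≠ 0 ∧ IsSignedPAdicLFunction f p ε L :=
  exists_isSignedPAdicLFunction pollack_exists_plusMinusPAdicLFunction_holds hp hf hgood hap ε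

/-- **Existence and uniqueness of `L_p^ε(E, X)`**, unconditionally: exactly one `L ∈ Λ` satisfies
`IsSignedPAdicLFunction f p ε L`, and it is non-zero (`existsUnique_isSignedPAdicLFunction` fed with
`pollack_exists_plusMinusPAdicLFunction_holds`). [cite: Pollack2003, Thm. 5.6, Cor. 5.11 and Prop. 6.18] [cite: Kobayashi2003, Thm. 3.2 (p. 7)] -/
theorem existsUnique_isSignedPAdicLFunction_holds (hp : p ≠ 2) (hf : IsNewformOf W f)
    (hgood : W.HasGoodReductionAtPrime p) (hap : W.frobeniusTrace p = 0) (ε : ℤˣ) :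
    (∃! L : IwasawaAlgebra p, IsSignedPAdicLFunction f p ε L) ∧
      ∀ L : IwasawaAlgebra p, IsSignedPAdicLFunction f p ε L → L ≠ 0 :=
  existsUnique_isSignedPAdicLFunction pollack_exists_plusMinusPAdicLFunction_holds hp hf hgood hap ε

/-- **The value at the trivial character**, unconditionally: there is a (unique, non-zero) `L_p^ε`
and its constant term is `c · [0]⁺_f` in `ℚ_p` for a natural number `c` prime to `p`
(`c = 2` for `ε = 1`, `c = p − 1` for `ε = −1`; Kobayashi 2003 (3.6), in the `Ω⁺_f`-normalisation
of the tree, `[0]⁺_f = L(f,1)/Ω⁺_f`). [cite: Kobayashi2003, (3.6) (p. 7)] [cite: Pollack2003, Prop. 6.18] -/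
theorem exists_isSignedPAdicLFunction_constantCoeff_eq (hp : p ≠ 2) (hf : IsNewformOf W f)
    (hgood : W.HasGoodReductionAtPrime p) (hap : W.frobeniusTrace p = 0) (ε : ℤˣ) :
    ∃ L : IwasawaAlgebra p, L ≠ 0 ∧ IsSignedPAdicLFunction f p ε L ∧
      ∃ c : ℕ, ¬ p ∣ c ∧
        ((PowerSeries.constantCoeff L : ℤ_[p]) : ℚ_[p]) = ((c * ratPlusSymbol f 0 : ℚ) : ℚ_[p]) := by
  obtain ⟨L, hL0, hL⟩ := exists_ne_zero_and_isSignedPAdicLFunction hp hf hgood hap ε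
  exact ⟨L, hL0, hL, IsSignedPAdicLFunction.exists_constantCoeff_eq hp hf hgood hap hL⟩

end Literature.NumberTheory.EllipticCurves.Kobayashi2003

end
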